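import Literature.Analysis.FluidPDE.SelfSimilarEulerStagnationStretching
import HarnessLib

/-!
# Self-similar Euler profiles: the weighted `L^{2a}` vorticity identity with a flow-monotone factor

Analysis/FluidPDE proofs file (theorems only), tools companion of
`SelfSimilarEulerBernoulliSuperlevel.lean` (third part of the Eulerian treatment of
Constantin–Ignatova–Vicol's Thm 3.10, arXiv:2602.17570 §3.5). One theorem:

* `IsSelfSimilarEulerVorticityProfile.curl_eq_zero_of_weight_of_antitone` — the weighted `L^{2a}`
  identity `∫ div (|Ω|^{2a} e^{ψ} ω τ V) = 0` of `SelfSimilarEulerOutgoingExclusionTools`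
  (`curl_eq_zero_of_weight`) with an extra `C¹` factor `ω ≥ 0` that is non-increasing along the
  self-similar transport field, `Dω[V] ≤ 0` (its term `|Ω|^{2a} e^{ψ} τ Dω[V]` has the good sign and
  is dropped, exactly like the radial cutoff's): if `⟪Ω, DU Ω⟫ ≤ m|Ω|²` on `B̄(c, 2R)`, the bracket
  `2a(m − 1) + Dψ[V] + 3γ ≤ −1` holds on `B̄(c, 2R) ∩ {ω > 0}`, and `⟪V, y − c⟫ ≥ 0` for
  `|y − c| ≥ R`, then `Ω = 0` on `B̄(c, R) ∩ {ω > 0}`.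

The consumer takes `ω = smoothTransition(ℋ − t)` with `ℋ` the self-similar Bernoulli function
(`V·∇ℋ = (2γ−1)|V|² ≤ 0` for `γ < ½`, CIV (3.31)), localising the vorticity-vanishing theorem to
Bernoulli superlevel sets.

## References

* P. Constantin, M. Ignatova, V. Vicol, arXiv:2602.17570 (2026), §3.4.3 (3.30)–(3.31), §3.5
  Thm. 3.10. [ConstantinIgnatovaVicol2026Putative]
* D. Chae, R. Shvydkoy, ARMA 209 (2013) = arXiv:1201.6009, §4 (the `|ω|^{p−2}ω` multiplier).
  [ChaeShvydkoy2013]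
-/

noncomputable section

open MeasureTheory Set Filter Function Topology InnerProductSpace Metric
open scoped RealInnerProductSpace NNReal

namespace Literature.Analysis.FluidPDE

/-! ### The weighted identity with a flow-monotone factor -/

namespace IsSelfSimilarEulerVorticityProfile

variable {γ : ℝ} {c : EuclideanSpace ℝ (Fin 3)}
  {U : EuclideanSpace ℝ (Fin 3) → EuclideanSpace ℝ (Fin 3)}

/-- **The weighted `L^{2a}` identity with a negative bracket and a flow-monotone factor.** As
`curl_eq_zero_of_weight` (vorticity-form profile, `a ≥ 1`, `ψ ∈ C¹`, `R > 0`, any `m` with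
`⟪Ω, DU Ω⟫ ≤ m|Ω|²` on `B̄(c, 2R)`, outward transport for `|y − c| ≥ R`), with an additional factor
`ω ∈ C¹`, `ω ≥ 0`, `Dω[V] ≤ 0`: if `2a(m − 1) + Dψ[V] + 3γ ≤ −1` on `B̄(c, 2R) ∩ {ω > 0}`, then
`Ω = 0` on `B̄(c, R) ∩ {ω > 0}` (integrate `div (|Ω|^{2a} e^{ψ} ω τ V) = 0`; the `ω`-term
`|Ω|^{2a} e^{ψ} τ Dω[V]` is `≤ 0`). [cite: ConstantinIgnatovaVicol2026Putative, §3.5 proof of Thm. 3.10 (Eulerian replacement, localised)] -/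
theorem curl_eq_zero_of_weight_of_antitone (h : IsSelfSimilarEulerVorticityProfile γ c U)
    {a : ℝ} (ha1 : 1 ≤ a) {ψ : EuclideanSpace ℝ (Fin 3) → ℝ} (hψ : ContDiff ℝ 1 ψ)
    {ω : EuclideanSpace ℝ (Fin 3) → ℝ} (hω : ContDiff ℝ 1 ω) (hω0 : ∀ y, 0 ≤ ω y)
    (hωV : ∀ y, fderiv ℝ ω y (selfSimilarTransport γ c U y) ≤ 0) {R : ℝ} (hR : 0 < R)
    {m : EuclideanSpace ℝ (Fin 3) → ℝ}
    (hm : ∀ y, ‖y - c‖ ≤ 2 * R →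
      ⟪curl U y, fderiv ℝ U y (curl U y)⟫ ≤ m y * ‖curl U y‖ ^ 2)
    (hbr : ∀ y, ‖y - c‖ ≤ 2 * R → 0 < ω y →
      2 * a * (m y - 1) + fderiv ℝ ψ y (selfSimilarTransport γ c U y) + 3 * γ ≤ -1)
    (hout : ∀ y, R ≤ ‖y - c‖ → 0 ≤ ⟪selfSimilarTransport γ c U y, y - c⟫) :
    ∀ y, ‖y - c‖ ≤ R → 0 < ω y → curl U y = 0 := by
  set Ω : EuclideanSpace ℝ (Fin 3) → EuclideanSpace ℝ (Fin 3) := curl U with hΩdef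
  set V : EuclideanSpace ℝ (Fin 3) → EuclideanSpace ℝ (Fin 3) := selfSimilarTransport γ c U
    with hVdef
  have ha : 0 < a := by linarith
  set G : EuclideanSpace ℝ (Fin 3) → ℝ := fun z => (‖Ω z‖ ^ 2) ^ a with hGdef
  set τ : EuclideanSpace ℝ (Fin 3) → ℝ := fun z => taoCutoff (2 * R) R (z - c) with hτdef
  set η : EuclideanSpace ℝ (Fin 3) → ℝ := fun z => Real.exp (ψ z) * ω z with hηdef
  set w : EuclideanSpace ℝ (Fin 3) → ℝ := fun z => η z * τ z with hwdef
  have hU2 : ContDiff ℝ 2 U := h.contDiff_velocity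
  have hΩ1 : ContDiff ℝ 1 Ω := contDiff_curl (n := 1) (by exact_mod_cast hU2)
  have hΩd : Differentiable ℝ Ω := h.differentiable_curl
  have hΩc : Continuous Ω := hΩ1.continuous
  have hUd : Differentiable ℝ U := hU2.differentiable (by norm_num)
  have hV1 : ContDiff ℝ 1 V := by
    have : ContDiff ℝ 1 fun y : EuclideanSpace ℝ (Fin 3) => γ • (y - c) + U y :=
      ((contDiff_id.sub contDiff_const).const_smul γ).add (hU2.of_le (by norm_num))
    exact this
  have hG1 : ContDiff ℝ 1 G := contDiff_rpow_norm_sq_of_one_le hΩ1 ha1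
  have hτ1 : ContDiff ℝ 1 τ := contDiff_taoCutoff_comp_sub (2 * R) R c
  have he1 : ContDiff ℝ 1 fun z => Real.exp (ψ z) := hψ.exp
  have hη1 : ContDiff ℝ 1 η := he1.mul hω
  have hw1 : ContDiff ℝ 1 w := hη1.mul hτ1
  have hΘ1 : ContDiff ℝ 1 (fun z => G z * w z) := hG1.mul hw1
  -- compact support of the test function (from `τ`)
  have hτc : HasCompactSupport τ := by
    refine HasCompactSupport.of_support_subset_isCompact (isCompact_closedBall c (2 * R))
      fun z hz => ?_
    rw [mem_closedBall, dist_eq_norm]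
    by_contra hcon
    exact hz (taoCutoff_comp_sub_eq_zero hR.le (not_le.1 hcon).le)
  have hwc : HasCompactSupport w := hτc.mul_left
  have hΘc : HasCompactSupport (fun z => G z * w z) := hwc.mul_left
  have hτ_mem : ∀ z, τ z ∈ Icc (0 : ℝ) 1 := fun z => taoCutoff_comp_sub_mem_Icc R c z
  have hη_nn : ∀ z, 0 ≤ η z := fun z => mul_nonneg (Real.exp_pos _).le (hω0 z)
  have hw_nn : ∀ z, 0 ≤ w z := fun z => mul_nonneg (hη_nn z) (hτ_mem z).1
  have hG_nn : ∀ z, 0 ≤ G z := fun z => Real.rpow_nonneg (sq_nonneg _) _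
  have hτ_zero : ∀ z, 2 * R < ‖z - c‖ → τ z = 0 := fun z hz =>
    taoCutoff_comp_sub_eq_zero hR.le hz.le
  -- integration by parts: `∫ Θ div V + ∫ ⟪V, ∇Θ⟫ = 0`, `div V = 3γ`
  have hibp := integral_mul_divergence_add_eq_zero_left hΘ1 hV1 hΘc
  have hdiv : ∀ y, VectorCalculus.divergence V y = 3 * γ := fun y =>
    divergence_selfSimilarTransport hUd h.divFree y
  simp_rw [hdiv] at hibp
  -- the derivative of the test function along `V`
  have hDτ : ∀ y, DifferentiableAt ℝ τ y := fun y => hτ1.differentiable one_ne_zero y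
  have hDG : ∀ y, DifferentiableAt ℝ G y := fun y => hG1.differentiable one_ne_zero y
  have hDw : ∀ y, DifferentiableAt ℝ w y := fun y => hw1.differentiable one_ne_zero y
  have hDψ : ∀ y, DifferentiableAt ℝ ψ y := fun y => hψ.differentiable one_ne_zero y
  have hDe : ∀ y, DifferentiableAt ℝ (fun z => Real.exp (ψ z)) y := fun y =>
    he1.differentiable one_ne_zero y
  have hDω : ∀ y, DifferentiableAt ℝ ω y := fun y => hω.differentiable one_ne_zero y
  have hDη : ∀ y, DifferentiableAt ℝ η y := fun y => hη1.differentiable one_ne_zero y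
  have hgrad : ∀ y, ⟪V y, gradient (fun z => G z * w z) y⟫ =
      w y * fderiv ℝ G y (V y) +
        G y * (η y * fderiv ℝ τ y (V y) + τ y * (Real.exp (ψ y) * fderiv ℝ ω y (V y) +
          ω y * (Real.exp (ψ y) * fderiv ℝ ψ y (V y)))) := by
    intro y
    rw [real_inner_comm, inner_gradient_left (𝕜 := ℝ), fderiv_fun_mul (hDG y) (hDw y)]
    have hw' : fderiv ℝ w y = η y • fderiv ℝ τ y + τ y • fderiv ℝ η y :=
      fderiv_fun_mul (hDη y) (hDτ y)
    have hη' : fderiv ℝ η y =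
        Real.exp (ψ y) • fderiv ℝ ω y + ω y • fderiv ℝ (fun z => Real.exp (ψ z)) y :=
      fderiv_fun_mul (hDe y) (hDω y)
    rw [hw', hη', fderiv_exp (hDψ y)]
    simp only [_root_.add_apply, _root_.smul_apply, smul_eq_mul]
    ring
  -- (1) the bracket: `w DG(V) + G (w Dψ(V)) + 3γ G w ≤ -G w` (where `ω > 0`; trivial elsewhere)
  have hT1 : ∀ y, w y * fderiv ℝ G y (V y) +
      G y * (τ y * (ω y * (Real.exp (ψ y) * fderiv ℝ ψ y (V y)))) +
      G y * w y * (3 * γ) ≤ -(G y * w y) := by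
    intro y
    by_cases hy : ‖y - c‖ ≤ 2 * R
    · by_cases hωy : 0 < ω y
      swap
      · have hω0y : ω y = 0 := le_antisymm (not_lt.1 hωy) (hω0 y)
        have hw0 : w y = 0 := by simp only [hwdef, hηdef, hω0y, mul_zero, zero_mul]
        rw [hw0, hω0y]
        simp
      have hid : fderiv ℝ G y (V y) =
          2 * a * (‖Ω y‖ ^ 2) ^ (a - 1) * (⟪Ω y, fderiv ℝ U y (Ω y)⟫ - ‖Ω y‖ ^ 2) := by
        rw [hGdef, fderiv_rpow_norm_sq_apply_of_one_le hΩd ha1, hΩdef, hVdef,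
          h.fderiv_curl_transport y, inner_sub_right, real_inner_self_eq_norm_sq]
      have hfe : 0 ≤ (‖Ω y‖ ^ 2) ^ (a - 1) := Real.rpow_nonneg (sq_nonneg _) _
      have hst : ⟪Ω y, fderiv ℝ U y (Ω y)⟫ - ‖Ω y‖ ^ 2 ≤ (m y - 1) * ‖Ω y‖ ^ 2 := by
        have := hm y hy
        linarith
      have hDG_le : fderiv ℝ G y (V y) ≤ 2 * a * (m y - 1) * G y := by
        rw [hid]
        have hkey : (‖Ω y‖ ^ 2) ^ (a - 1) * ‖Ω y‖ ^ 2 = G y :=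
          rpow_sub_one_mul_self_eq_rpow (sq_nonneg _) ha
        calc 2 * a * (‖Ω y‖ ^ 2) ^ (a - 1) * (⟪Ω y, fderiv ℝ U y (Ω y)⟫ - ‖Ω y‖ ^ 2)
            ≤ 2 * a * (‖Ω y‖ ^ 2) ^ (a - 1) * ((m y - 1) * ‖Ω y‖ ^ 2) :=
              mul_le_mul_of_nonneg_left hst (by positivity)
          _ = 2 * a * (m y - 1) * ((‖Ω y‖ ^ 2) ^ (a - 1) * ‖Ω y‖ ^ 2) := by ring
          _ = 2 * a * (m y - 1) * G y := by rw [hkey]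
      have hb := hbr y hy hωy
      have hwy := hw_nn y
      have hGy := hG_nn y
      have e1 : w y * fderiv ℝ G y (V y) ≤ w y * (2 * a * (m y - 1) * G y) :=
        mul_le_mul_of_nonneg_left hDG_le hwy
      have e2 : G y * (τ y * (ω y * (Real.exp (ψ y) * fderiv ℝ ψ y (V y)))) =
          G y * w y * fderiv ℝ ψ y (V y) := by
        simp only [hwdef, hηdef]; ring
      rw [e2]
      have e3 : w y * (2 * a * (m y - 1) * G y) + G y * w y * fderiv ℝ ψ y (V y) +
          G y * w y * (3 * γ) = G y * w y * (2 * a * (m y - 1) + fderiv ℝ ψ y (V y) + 3 * γ) := by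
        ring
      have e4 : G y * w y * (2 * a * (m y - 1) + fderiv ℝ ψ y (V y) + 3 * γ) ≤
          G y * w y * (-1) := mul_le_mul_of_nonneg_left hb (mul_nonneg hGy hwy)
      linarith
    · -- outside `B̄(c, 2R)` the test function and its derivative vanish
      have hy' : 2 * R < ‖y - c‖ := not_le.1 hy
      have hτ0 : τ y = 0 := hτ_zero y hy'
      have hw0 : w y = 0 := by simp only [hwdef, hτ0, mul_zero]
      rw [hw0, hτ0]
      simp
  -- (2) the cutoff term has a sign: `G η Dτ(V) ≤ 0`
  have hT2 : ∀ y, G y * (η y * fderiv ℝ τ y (V y)) ≤ 0 := by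
    intro y
    have hτ' : fderiv ℝ τ y (V y) ≤ 0 := by
      by_cases hy : ‖y - c‖ < R
      · have h0 : fderiv ℝ τ y = 0 := fderiv_taoCutoff_comp_sub_eq_zero_of_lt hR hy
        rw [h0]
        simp
      · have hsign : 0 ≤ ⟪y - c, V y⟫ := by
          rw [real_inner_comm]; exact hout y (not_lt.1 hy)
        rw [hτdef, fderiv_taoCutoff_comp_sub_apply]
        have h1 : 0 ≤ deriv Real.smoothTransition
            (((2 * R) ^ 2 - ‖y - c‖ ^ 2) / (R * (2 * R))) :=
          Real.smoothTransition.monotone.deriv_nonneg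
        have h2 : -(2 / (R * (2 * R))) * ⟪y - c, V y⟫ ≤ 0 := by
          have : 0 ≤ 2 / (R * (2 * R)) * ⟪y - c, V y⟫ := mul_nonneg (by positivity) hsign
          linarith
        exact mul_nonpos_of_nonneg_of_nonpos h1 h2
    have := mul_nonpos_of_nonneg_of_nonpos (hη_nn y) hτ'
    exact mul_nonpos_of_nonneg_of_nonpos (hG_nn y) this
  -- (3) the monotone-weight term has a sign: `G τ e^ψ Dω(V) ≤ 0`
  have hT3 : ∀ y, G y * (τ y * (Real.exp (ψ y) * fderiv ℝ ω y (V y))) ≤ 0 := by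
    intro y
    have h1 : Real.exp (ψ y) * fderiv ℝ ω y (V y) ≤ 0 :=
      mul_nonpos_of_nonneg_of_nonpos (Real.exp_pos _).le (hωV y)
    exact mul_nonpos_of_nonneg_of_nonpos (hG_nn y)
      (mul_nonpos_of_nonneg_of_nonpos (hτ_mem y).1 h1)
  have hGc' : Continuous G := hG1.continuous
  have hwc' : Continuous w := hw1.continuous
  have hIΘ : Integrable (fun y => G y * w y) := (hGc'.mul hwc').integrable_of_hasCompactSupport hΘc
  have hIgrad : Integrable (fun y => ⟪V y, gradient (fun z => G z * w z) y⟫) := by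
    refine (hV1.continuous.inner (continuous_gradient_of_contDiff hΘ1))
      |>.integrable_of_hasCompactSupport (hΘc.mono' fun x hx => ?_)
    contrapose! hx
    simp only [mem_support, not_not]
    rw [gradient_eq_zero_of_notMem_tsupport hx, inner_zero_right]
  -- assemble: `0 = ∫ (3γ Θ + ⟪V, ∇Θ⟫) ≤ -∫ Θ`
  have hptw : ∀ y, (G y * w y) * (3 * γ) + ⟪V y, gradient (fun z => G z * w z) y⟫ ≤
      -(G y * w y) := by
    intro y
    rw [hgrad y]
    have := hT1 y
    have := hT2 y
    have := hT3 y
    nlinarith [hG_nn y]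
  have hle : (∫ y, (G y * w y) * (3 * γ)) + ∫ y, ⟪V y, gradient (fun z => G z * w z) y⟫ ≤
      ∫ y, -(G y * w y) := by
    rw [← integral_add (hIΘ.mul_const _) hIgrad]
    exact integral_mono ((hIΘ.mul_const _).add hIgrad) hIΘ.neg hptw
  rw [hibp, integral_neg] at hle
  -- hence `∫ Θ = 0`, so `Θ ≡ 0` by continuity
  have hΘ_nn : ∀ y, 0 ≤ G y * w y := fun y => mul_nonneg (hG_nn y) (hw_nn y)
  have hI0 : ∫ y, G y * w y = 0 := le_antisymm (by linarith) (integral_nonneg hΘ_nn)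
  have hae : (fun y => G y * w y) =ᵐ[volume] 0 :=
    (integral_eq_zero_iff_of_nonneg hΘ_nn hIΘ).1 hI0
  have hΘ0 : (fun y => G y * w y) = 0 := ((hGc'.mul hwc').ae_eq_iff_eq volume continuous_zero).1 hae
  -- read off `Ω = 0` on `B̄(c, R) ∩ {ω > 0}`, where `τ = 1`
  intro y hy hωy
  have hτ1' : τ y = 1 := taoCutoff_comp_sub_eq_one hR hy
  have hwy : 0 < w y := by
    simp only [hwdef, hηdef, hτ1', mul_one]
    exact mul_pos (Real.exp_pos _) hωy
  have hGy : G y = 0 := by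
    have e := congrFun hΘ0 y
    simp only [Pi.zero_apply, mul_eq_zero] at e
    rcases e with e | e
    · exact e
    · exact absurd e hwy.ne'
  have hsq : ‖Ω y‖ ^ 2 = 0 := by
    rcases (Real.rpow_eq_zero (sq_nonneg _) ha.ne').1 hGy with h0
    exact h0
  have : Ω y = 0 := by
    rw [← norm_eq_zero]
    exact pow_eq_zero_iff (n := 2) (by norm_num) |>.1 hsq
  simpa [hΩdef] using this


end IsSelfSimilarEulerVorticityProfile

end Literature.Analysis.FluidPDE

end
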